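import Mathlib.Analysis.SpecialFunctions.Complex.Log
import Mathlib.Analysis.SpecialFunctions.Trigonometric.Basic
import HarnessLib

/-!
# An ellipse about the origin is deformable, off the origin, to a round circle

Helper layer `helper_timelike_ellipseLoop` (generic plane topology) of stub `helper_foldNF_timelike`
(the untwistedness of the round `1`-handle of a genus-one simplified broken Lefschetz
fibration), line `Sketch`, crux `SblfDescent.RungOne`.

(Crux item stmt-SmoothPoincare4-18531; skeleton `Cruxes/RungOne/Lines/Sketch.lean`.)

In a fold chart the vanishing cycle of an arbitrary transverse slice projects to the spacelike
coordinate plane as an ELLIPSE `θ ↦ cos 2πθ · p + sin 2πθ · q` (`p`, `q ∈ ℝ² ≅ ℂ` linearly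
independent), while the core circle of the model is the round circle.  This file joins the two
(`helper_timelike_ellipseLoop`): there is a continuous family of closed curves of `ℂ ∖ 0` from
the ellipse to the unit circle traversed with the sign `ε = ±1` of `det (p, q)` — shear `q` to
`ε i p` (the determinant keeps its sign, so the curves avoid `0`), while contracting the factor
`p` to `1` along `exp ((1 - s) log p)`.  (`GL₂(ℝ)` has two components.)

## References

* A. Hatcher, *Algebraic Topology* (2002), §1.1 (loops of the punctured plane). [HatcherAT2002]
-/

set_option linter.dupNamespace false

noncomputable section

open scoped Topology
open Set Function Filter Complex

namespace Summit.SmoothPoincare4.SmoothPoincare4.Cruxes.RungOne.Sketch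

/-- **`ℝ`-independent complex numbers do not combine to zero**: if `Im (conj p · q) ≠ 0` then
`a p + b q = 0` forces `a = b = 0` (real `a`, `b`). [folklore] -/
theorem eq_zero_of_real_combo_eq_zero {p q : ℂ} (h : p.re * q.im - p.im * q.re ≠ 0) {a b : ℝ}
    (hab : (a : ℂ) * p + (b : ℂ) * q = 0) : a = 0 ∧ b = 0 := by
  have hre : a * p.re + b * q.re = 0 := by
    have := congrArg Complex.re hab; simpa using this
  have him : a * p.im + b * q.im = 0 := by
    have := congrArg Complex.im hab; simpa using this
  have ha : a * (p.re * q.im - p.im * q.re) = 0 := by linear_combination q.im * hre - q.re * him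
  have hb : b * (p.re * q.im - p.im * q.re) = 0 := by linear_combination p.re * him - p.im * hre
  exact ⟨(mul_eq_zero.1 ha).resolve_right h, (mul_eq_zero.1 hb).resolve_right h⟩

/-- **An ellipse about the origin deforms, off the origin, to the unit circle traversed `±`.**
For `p, q ∈ ℂ` linearly independent over `ℝ` there are `ε = ±1` and a continuous
`E : ℝ × ℝ → ℂ ∖ 0`, `1`-periodic in `θ`, with `E (0, θ) = cos 2πθ · p + sin 2πθ · q` and
`E (1, θ) = exp (2πi ε θ)`. [cite: HatcherAT2002, §1.1] -/
theorem helper_timelike_ellipseLoop : ∀ (p q : ℂ), p.re * q.im - p.im * q.re ≠ 0 → ∃ (ε : ℤ) (E : ℝ × ℝ → ℂ), (ε = 1 ∨ ε = -1) ∧ Continuous E ∧ (∀ s θ : ℝ, E (s, θ) ≠ 0) ∧ (∀ s θ : ℝ, E (s, θ + 1) = E (s, θ)) ∧ (∀ θ : ℝ, E (0, θ) = (Real.cos (2 * Real.pi * θ) : ℂ) * p + (Real.sin (2 * Real.pi * θ) : ℂ) * q) ∧ (∀ θ : ℝ, E (1, θ) = Complex.exp (2 * Real.pi * ε * θ * Complex.I))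 := by
  intro p q hdet
  have hp : p ≠ 0 := by
    rintro rfl; simp at hdet
  -- the sign `ε` of `det (p, q)`; `det (p, ε i p) = ε |p|²` has the same sign
  obtain ⟨ε, hε, hεsign⟩ : ∃ ε : ℤ, (ε = 1 ∨ ε = -1) ∧ 0 < (ε : ℝ) * (p.re * q.im - p.im * q.re) := by
    rcases lt_or_gt_of_ne hdet with h | h
    · exact ⟨-1, Or.inr rfl, by push_cast; nlinarith⟩
    · exact ⟨1, Or.inl rfl, by push_cast; nlinarith⟩
  set J : ℂ := (ε : ℂ) * Complex.I * p with hJ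
  have hJdet : p.re * J.im - p.im * J.re = (ε : ℝ) * (p.re ^ 2 + p.im ^ 2) := by
    simp only [hJ, mul_re, mul_im, Complex.I_re, Complex.I_im, intCast_re, intCast_im]
    ring
  have hp2 : 0 < p.re ^ 2 + p.im ^ 2 := by
    rcases Complex.ext_iff.not.1 hp |> not_and_or.1 with h | h
    · have : p.re ≠ 0 := by simpa using h
      positivity
    · have : p.im ≠ 0 := by simpa using h
      positivity
  -- the clamp `σ` and the sheared second vector `q_s = (1 - σ) q + σ J`
  set σ : ℝ → ℝ := fun s => max 0 (min 1 s) with hσ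
  have hσc : Continuous σ := continuous_const.max (continuous_const.min continuous_id)
  have hσ01 : ∀ s, 0 ≤ σ s ∧ σ s ≤ 1 := fun s =>
    ⟨le_max_left _ _, max_le zero_le_one (min_le_left _ _)⟩
  have hσ0 : σ 0 = 0 := by simp [hσ]
  have hσ1 : σ 1 = 1 := by simp [hσ]
  set qs : ℝ → ℂ := fun s => ((1 - σ s : ℝ) : ℂ) * q + ((σ s : ℝ) : ℂ) * J with hqs
  have hεε : (ε : ℝ) * (ε : ℝ) = 1 := by rcases hε with rfl | rfl <;> norm_num
  have hεX : (ε : ℝ) * ((ε : ℝ) * (p.re ^ 2 + p.im ^ 2)) = p.re ^ 2 + p.im ^ 2 := by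
    rw [← mul_assoc, hεε, one_mul]
  have hqsdet : ∀ s, p.re * (qs s).im - p.im * (qs s).re ≠ 0 := fun s => by
    have e : p.re * (qs s).im - p.im * (qs s).re =
        (1 - σ s) * (p.re * q.im - p.im * q.re) + σ s * (p.re * J.im - p.im * J.re) := by
      simp only [hqs, add_re, add_im, mul_re, mul_im, ofReal_re, ofReal_im, zero_mul, sub_zero,
        add_zero]
      ring
    rw [e, hJdet]
    intro h0
    have h1 : 0 ≤ (1 - σ s) * ((ε : ℝ) * (p.re * q.im - p.im * q.re)) :=
      mul_nonneg (sub_nonneg.2 (hσ01 s).2) hεsign.le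
    have h2 : 0 ≤ σ s * ((ε : ℝ) * ((ε : ℝ) * (p.re ^ 2 + p.im ^ 2))) := by
      rw [hεX]
      exact mul_nonneg (hσ01 s).1 hp2.le
    have h3 : (ε : ℝ) * ((1 - σ s) * (p.re * q.im - p.im * q.re) +
        σ s * ((ε : ℝ) * (p.re ^ 2 + p.im ^ 2))) = 0 := by rw [h0, mul_zero]
    have h4 : 0 < (1 - σ s) * ((ε : ℝ) * (p.re * q.im - p.im * q.re)) +
        σ s * ((ε : ℝ) * ((ε : ℝ) * (p.re ^ 2 + p.im ^ 2))) := by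
      rcases eq_or_lt_of_le (hσ01 s).1 with hz | hz
      · rw [← hz]; simp only [sub_zero, one_mul, zero_mul, add_zero]; exact hεsign
      · rw [hεX]
        exact add_pos_of_nonneg_of_pos h1 (mul_pos hz hp2)
    nlinarith [h3, h4]
  -- the contracting factor `a_s = exp ((1 - σ) log p)`, from `p` to `1`
  set as : ℝ → ℂ := fun s => Complex.exp (((1 - σ s : ℝ) : ℂ) * Complex.log p) with has
  have has0 : as 0 = p := by simp [has, hσ0, Complex.exp_log hp]
  have has1 : as 1 = 1 := by simp [has, hσ1]
  have hasne : ∀ s, as s ≠ 0 := fun s => Complex.exp_ne_zero _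
  -- the family
  set E : ℝ × ℝ → ℂ := fun x => as x.1 * p⁻¹ *
    ((Real.cos (2 * Real.pi * x.2) : ℂ) * p + (Real.sin (2 * Real.pi * x.2) : ℂ) * qs x.1) with hE
  refine ⟨ε, E, hε, ?_, fun s θ => ?_, fun s θ => ?_, fun θ => ?_, fun θ => ?_⟩
  · have h1 : Continuous as := by
      simp only [has]
      exact Complex.continuous_exp.comp ((continuous_ofReal.comp (continuous_const.sub hσc)).mul
        continuous_const)
    have h2 : Continuous qs :=
      ((continuous_ofReal.comp (continuous_const.sub hσc)).mul continuous_const).add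
        ((continuous_ofReal.comp hσc).mul continuous_const)
    have h3 : Continuous fun x : ℝ × ℝ => (Real.cos (2 * Real.pi * x.2) : ℂ) :=
      continuous_ofReal.comp (by fun_prop)
    have h4 : Continuous fun x : ℝ × ℝ => (Real.sin (2 * Real.pi * x.2) : ℂ) :=
      continuous_ofReal.comp (by fun_prop)
    exact ((h1.comp continuous_fst).mul continuous_const).mul
      ((h3.mul continuous_const).add (h4.mul (h2.comp continuous_fst)))
  · simp only [hE]
    refine mul_ne_zero (mul_ne_zero (hasne s) (inv_ne_zero hp)) fun h0 => ?_
    obtain ⟨hc, hs⟩ := eq_zero_of_real_combo_eq_zero (hqsdet s) h0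
    have := Real.cos_sq_add_sin_sq (2 * Real.pi * θ)
    rw [hc, hs] at this
    norm_num at this
  · simp only [hE, mul_add, mul_one, Real.cos_add_two_pi, Real.sin_add_two_pi]
  · simp only [hE, has0, hqs, hσ0, sub_zero, ofReal_one, one_mul, ofReal_zero, zero_mul, add_zero]
    field_simp
  · simp only [hE, has1, hqs, hσ1, sub_self, ofReal_zero, zero_mul, ofReal_one, one_mul, zero_add,
      hJ]
    have e1 : p⁻¹ * ((Real.cos (2 * Real.pi * θ) : ℂ) * p +
        (Real.sin (2 * Real.pi * θ) : ℂ) * ((ε : ℂ) * Complex.I * p)) =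
        (Real.cos (2 * Real.pi * θ) : ℂ) + (Real.sin (2 * Real.pi * θ) : ℂ) * (ε : ℂ) * Complex.I := by
      field_simp
    rw [e1]
    rcases hε with rfl | rfl
    · push_cast
      rw [mul_one, show (2 * (Real.pi : ℂ) * 1 * (θ : ℂ) * Complex.I) = ((2 * Real.pi * θ : ℝ) : ℂ) * Complex.I by
        push_cast; ring, Complex.exp_mul_I]
      push_cast; ring
    · push_cast
      rw [show (2 * (Real.pi : ℂ) * (-1) * (θ : ℂ) * Complex.I) = ((-(2 * Real.pi * θ) : ℝ) : ℂ) * Complex.I by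
        push_cast; ring, Complex.exp_mul_I]
      push_cast
      rw [Complex.cos_neg, Complex.sin_neg]
      ring

end Summit.SmoothPoincare4.SmoothPoincare4.Cruxes.RungOne.Sketch

end
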